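import Summits.AtomisticToContinuum.BoseEinsteinCondensation.Theorems.BECThomsonPrincipleDensityResponseTransportedState
import Summits.AtomisticToContinuum.BoseEinsteinCondensation.Theorems.BECThomsonPrincipleDensityResponseKineticSignCoherence

/-!
# Route `BECThomsonPrinciple`, crux `DensityResponse` (stmt-AtomisticToContinuum-9481),
# line `force-balance-constitutive` — sub-goal `stub_kineticFlattening` of stub S1
# (`TransportStationary`)

The KINETIC ENERGY OF THE TRANSPORTED WAVE FUNCTION IN FLATTENED VARIABLES. With the transport flow
`F_h = transportFlow L n h` (`Theorems/BECThomsonPrincipleDensityResponseTransportFlow.lean`), its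
Jacobian `J_h = det DF_h = ∏ᵢ (cosh h - cos θᵢ sinh h)⁻¹`, the half-density weight
`W_h = transportWeight L n h` and the transported wave function `φ^h = transportFun L n h φ =
(φ ∘ F_{-h}) · W_h` (`Theorems/BECThomsonPrincipleDensityResponseTransportState.lean`), the kinetic
energy `∫_cell |∇φ^h|²` (`kineticDensityReal` of `Literature/.../OneBodyCurrentGain.lean`) is NOT
differentiable in `h` term by term for `φ ∈ C¹` (the `h`-derivative of `∇φ(F_{-h}X)` needs `∇²φ`).
After the torus change of variables `X = F_h(Y)` it is:

* the GRADIENT IN FLATTENED VARIABLES (`fderiv_transportFun_transportFlow_single`): by the chain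
  rule for `φ ∘ F_{-h}` at `F_h Y` (`F_{-h} ∘ F_h = id`, and the Jacobian block of `F_{-h}` at
  `F_h Y` dilates `k` by `cosh h - cos θᵢ sinh h`, the reciprocal factor
  `jacFactor_neg_add_angleFlow`) and the logarithmic derivative of the weight
  (`∂_{i,c} W_h = W_h · sinh h sin θᵢ k_c / (2(cosh h + cos θᵢ sinh h))`, which at `F_h Y` is
  `W_h(F_h Y) · sinh h sin θᵢ(Y) k_c / 2` by the sine boost formula `sin_add_angleFlow_mul`),
  `∂_{i,c} φ^h (F_h Y) = W_h(F_h Y) · [∂_{i,c}φ(Y) + ((cosh h - cos θᵢ sinh h - 1) k_c/|k|²) k·∇ᵢφ(Y)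
  + (sinh h sin θᵢ k_c / 2) φ(Y)]`, `k_c = 2πn_c/L`, an expression in `φ(Y)`, `∇φ(Y)` and smooth
  explicit functions of `(h, Y)` only;
* the FLATTENED KINETIC DENSITY `flatKineticDensity L n φ h Y = ∑_{i,c} |[…]|²` and the pointwise
  identity `|∇φ^h|²(F_h Y) · det DF_h(Y) = flatKineticDensity L n φ h Y` (`W_h(F_h Y)² = (det DF_h Y)⁻¹`,
  `transportWeight_transportFlow_sq`);
* the FLATTENING `∫_cell |∇φ^h|² dX = ∫_cell flatKineticDensity L n φ h Y dY` for `C¹` lattice-periodic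
  `φ`, `L > 0`, `|k|² ≠ 0` (Bochner torus change of variables `integral_cellN_comp_equivariant` of
  `Literature/.../PeriodicCellChangeOfVariables.lean`; the kinetic density of a periodic function is
  periodic).

The registered sub-goal `stub_kineticFlattening` packages the pointwise identity and the flattening.
Elementary calculus; no named facts. The `h`-derivative (the kinetic first variation
`-(K_k + (|k|²/4) m)`) is NOT in this file.
-/

namespace Summit.AtomisticToContinuum.BoseEinsteinCondensation.Cruxes.DensityResponse.ForceBalanceConstitutive

noncomputable section

open Real MeasureTheory
open scoped ENNReal
open Literature.MathematicalPhysics.QuantumManyBody.BoseGas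

variable {N : ℕ} {L : ℝ} {n : Fin 3 → ℤ}

/-! ### Coordinate vectors, the phase functional and the Jacobian blocks -/

/-- `k · e_c = k_c = 2π n_c / L`. [folklore] -/
theorem kdual_single (L : ℝ) (n : Fin 3 → ℤ) (c : Fin 3) :
    kdual L n (EuclideanSpace.single c 1) = 2 * π / L * (n c : ℝ) := by
  show 2 * π / L * ∑ j, (n j : ℝ) * EuclideanSpace.single c (1 : ℝ) j = _
  simp only [PiLp.single_apply, mul_ite, mul_one, mul_zero, Finset.sum_ite_eq',
    Finset.mem_univ, if_true]

/-- The phase of a one-particle vector put in slot `i`: `θⱼ(y in slot i) = [j = i] k·y`. [folklore] -/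
theorem phase_single (L : ℝ) (n : Fin 3 → ℤ) (i j : Fin N) (y : Space) :
    phase L n (Pi.single i y : Config N) j = if j = i then kdual L n y else 0 := by
  rw [phase_eq_kdual, Pi.single_apply, apply_ite (kdual L n), map_zero]

/-- The Jacobian of the flow on a coordinate vector:
`DF_τ(X) e_{i,c} = e_{i,c} + (((D(τ,θᵢ)⁻¹ - 1)/|k|²) k_c) · (k in slot i)`. [folklore] -/
theorem transportDeriv_apply_single (L : ℝ) (n : Fin 3 → ℤ) (τ : ℝ) (X : Config N) (i : Fin N)
    (c : Fin 3) :
    transportDeriv L n τ X (Pi.single i (EuclideanSpace.single c 1)) =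
      Pi.single i (EuclideanSpace.single c 1) +
        (((cosh τ - cos (phase L n X i) * sinh τ)⁻¹ - 1) / ksq L n * (2 * π / L * (n c : ℝ))) •
          (Pi.single i (kvec L n) : Config N) := by
  funext j
  rw [transportDeriv_apply, Pi.add_apply, Pi.smul_apply, phase_single, kdual_single]
  rcases eq_or_ne j i with rfl | hj
  · simp only [if_true, Pi.single_eq_same]
  · simp only [if_neg hj, Pi.single_eq_of_ne hj, mul_zero, zero_smul, smul_zero, add_zero]

/-- Linearity of the Fréchet derivative on slot vectors:
`Dφ(Y)[e_{i,c} + r (k in slot i)] = ∂_{i,c}φ(Y) + r k·∇ᵢφ(Y)`. [folklore] -/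
theorem fderiv_apply_single_add_smul (L : ℝ) (n : Fin 3 → ℤ) (φ : Config N → ℂ) (Y : Config N)
    (i : Fin N) (c : Fin 3) (r : ℝ) :
    fderiv ℝ φ Y (Pi.single i (EuclideanSpace.single c 1) + r • (Pi.single i (kvec L n) : Config N)) =
      fderiv ℝ φ Y (Pi.single i (EuclideanSpace.single c 1)) + r • kDeriv L n φ Y i := by
  rw [map_add, map_smul]
  rfl

/-- In flattened variables the Jacobian factor of `F_{-h}` is the reciprocal one:
`D(-h, θᵢ(F_h Y))⁻¹ = cosh h - cos θᵢ(Y) sinh h`. [folklore] -/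
theorem jacFactor_inv_transportFlow (hk : ksq L n ≠ 0) (h : ℝ) (Y : Config N) (i : Fin N) :
    (cosh (-h) - cos (phase L n (transportFlow L n h Y) i) * sinh (-h))⁻¹ =
      cosh h - cos (phase L n Y i) * sinh h := by
  rw [cosh_neg, sinh_neg, mul_neg, sub_neg_eq_add, phase_transportFlow hk, jacFactor_neg_add_angleFlow,
    inv_inv]

/-- In flattened variables the logarithmic derivative of the weight flattens:
`sinh h sin θᵢ' k_c / (2 (cosh h + cos θᵢ' sinh h)) = sinh h sin θᵢ k_c / 2` for
`θᵢ' = θᵢ(F_h Y) = θᵢ + δ(h, θᵢ)` (sine boost formula). [folklore] -/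
theorem weightLogDeriv_transportFlow (hk : ksq L n ≠ 0) (h : ℝ) (Y : Config N) (i : Fin N) (kc : ℝ) :
    sinh h * sin (phase L n (transportFlow L n h Y) i) * kc /
        (2 * (cosh h + cos (phase L n (transportFlow L n h Y) i) * sinh h)) =
      sinh h * sin (phase L n Y i) * kc / 2 := by
  rw [phase_transportFlow hk, jacFactor_neg_add_angleFlow]
  have hs := sin_add_angleFlow_mul h (phase L n Y i)
  have hD := (jacFactor_pos h (phase L n Y i)).ne'
  rw [← hs]
  field_simp

/-! ### The chain rule for `φ ∘ F_{-h}` and the derivative of the weight -/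

/-- CHAIN RULE IN FLATTENED VARIABLES: `D(φ ∘ F_{-h})(F_h Y) = Dφ(Y) ∘ DF_{-h}(F_h Y)`
(`F_{-h}(F_h Y) = Y`). [folklore] -/
theorem hasFDerivAt_comp_transportFlow_neg (L : ℝ) (n : Fin 3 → ℤ) {φ : Config N → ℂ}
    {Y : Config N} (hφ : DifferentiableAt ℝ φ Y) (h : ℝ) :
    HasFDerivAt (fun X => φ (transportFlow L n (-h) X))
      ((fderiv ℝ φ Y).comp (transportDeriv L n (-h) (transportFlow L n h Y)))
      (transportFlow L n h Y) := by
  have hY : transportFlow L n (-h) (transportFlow L n h Y) = Y := transportFlow_neg_transportFlow L n h Y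
  have hd : HasFDerivAt φ (fderiv ℝ φ Y) (transportFlow L n (-h) (transportFlow L n h Y)) := by
    rw [hY]
    exact hφ.hasFDerivAt
  exact hd.comp _ (hasFDerivAt_transportFlow L n (-h) _)

/-- The one-variable derivative of a weight factor:
`d/dθ (√(cosh h + cos θ sinh h))⁻¹ = (√(cosh h + cos θ sinh h))⁻¹ · sinh h sin θ / (2(cosh h + cos θ sinh h))`.
[folklore] -/
theorem hasDerivAt_inv_sqrt_jacFactor (h θ : ℝ) :
    HasDerivAt (fun x => (Real.sqrt (cosh h + cos x * sinh h))⁻¹)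
      ((Real.sqrt (cosh h + cos θ * sinh h))⁻¹ *
        (sinh h * sin θ / (2 * (cosh h + cos θ * sinh h)))) θ := by
  have ha := jacFactor_neg_pos h θ
  have hs : Real.sqrt (cosh h + cos θ * sinh h) ≠ 0 := (Real.sqrt_pos.2 ha).ne'
  have h1 : HasDerivAt (fun x => cosh h + cos x * sinh h) (-sin θ * sinh h) θ :=
    ((hasDerivAt_cos θ).mul_const (sinh h)).const_add (cosh h)
  refine ((h1.sqrt ha.ne').inv hs).congr_deriv ?_
  rw [Real.sq_sqrt ha.le]
  field_simp

/-- THE FRÉCHET DERIVATIVE OF THE WEIGHT `W_h = ∏ⱼ (√(cosh h + cos θⱼ sinh h))⁻¹` (product rule over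
the particles, chain rule through the linear phases). [folklore] -/
theorem hasFDerivAt_transportWeight (L : ℝ) (n : Fin 3 → ℤ) (h : ℝ) (X : Config N) :
    HasFDerivAt (transportWeight (N := N) L n h)
      (∑ i, (∏ j ∈ Finset.univ.erase i, (Real.sqrt (cosh h + cos (phase L n X j) * sinh h))⁻¹) •
        (((Real.sqrt (cosh h + cos (phase L n X i) * sinh h))⁻¹ *
            (sinh h * sin (phase L n X i) / (2 * (cosh h + cos (phase L n X i) * sinh h)))) •
          ((kdual L n).comp (ContinuousLinearMap.proj i)))) X := by
  have hW : transportWeight (N := N) L n h =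
      fun X => ∏ i, (Real.sqrt (cosh h + cos (phase L n X i) * sinh h))⁻¹ := rfl
  rw [hW]
  refine HasFDerivAt.finsetProd fun i _ => ?_
  have hθ : HasFDerivAt (fun Y : Config N => phase L n Y i)
      ((kdual L n).comp (ContinuousLinearMap.proj i)) X :=
    ((kdual L n).hasFDerivAt).comp X (hasFDerivAt_apply i X)
  have hc := (hasDerivAt_inv_sqrt_jacFactor h (phase L n X i)).comp_hasFDerivAt X hθ
  exact hc

/-- THE LOGARITHMIC DERIVATIVE OF THE WEIGHT along a coordinate:
`∂_{i,c} W_h(X) = W_h(X) · sinh h sin θᵢ k_c / (2(cosh h + cos θᵢ sinh h))`. [folklore] -/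
theorem fderiv_transportWeight_single (L : ℝ) (n : Fin 3 → ℤ) (h : ℝ) (X : Config N) (i : Fin N)
    (c : Fin 3) :
    fderiv ℝ (transportWeight L n h) X (Pi.single i (EuclideanSpace.single c 1)) =
      transportWeight L n h X * (sinh h * sin (phase L n X i) * (2 * π / L * (n c : ℝ)) /
        (2 * (cosh h + cos (phase L n X i) * sinh h))) := by
  rw [(hasFDerivAt_transportWeight L n h X).fderiv]
  simp only [FunLike.coe_sum, Finset.sum_apply, FunLike.coe_smul,
    Pi.smul_apply, ContinuousLinearMap.coe_comp, Function.comp_apply,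
    ContinuousLinearMap.proj_apply, smul_eq_mul]
  rw [Finset.sum_eq_single i]
  · rw [Pi.single_eq_same, kdual_single, transportWeight,
      ← Finset.prod_erase_mul _ _ (Finset.mem_univ i)]
    ring
  · intro j _ hj
    rw [Pi.single_eq_of_ne hj, map_zero, mul_zero, mul_zero]
  · intro hi
    exact absurd (Finset.mem_univ i) hi

/-! ### The gradient of the transported wave function in flattened variables -/

/-- **THE GRADIENT IN FLATTENED VARIABLES.** For differentiable `φ`, `|k|² ≠ 0` and every `h`, `Y`,
`i`, `c`:
`∂_{i,c}φ^h(F_h Y) = W_h(F_h Y) · [∂_{i,c}φ(Y) + ((cosh h - cos θᵢ sinh h - 1) k_c/|k|²) k·∇ᵢφ(Y)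
 + (sinh h sin θᵢ k_c/2) φ(Y)]` (product and chain rules; no second derivatives of `φ`). [folklore] -/
theorem fderiv_transportFun_transportFlow_single (hk : ksq L n ≠ 0) {φ : Config N → ℂ}
    (hφ : Differentiable ℝ φ) (h : ℝ) (Y : Config N) (i : Fin N) (c : Fin 3) :
    fderiv ℝ (transportFun L n h φ) (transportFlow L n h Y) (Pi.single i (EuclideanSpace.single c 1)) =
      (transportWeight L n h (transportFlow L n h Y) : ℂ) *
        (fderiv ℝ φ Y (Pi.single i (EuclideanSpace.single c 1)) +
          ((cosh h - cos (phase L n Y i) * sinh h - 1) * (2 * π / L * (n c : ℝ)) / ksq L n) •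
            kDeriv L n φ Y i +
          (sinh h * sin (phase L n Y i) * (2 * π / L * (n c : ℝ)) / 2) • φ Y) := by
  have h1 := hasFDerivAt_comp_transportFlow_neg L n (hφ Y) h
  have h2 : HasFDerivAt (fun X => (transportWeight L n h X : ℂ))
      (Complex.ofRealCLM.comp (fderiv ℝ (transportWeight L n h) (transportFlow L n h Y)))
      (transportFlow L n h Y) :=
    Complex.ofRealCLM.hasFDerivAt.comp _
      (hasFDerivAt_transportWeight L n h _).differentiableAt.hasFDerivAt
  have h3 : HasFDerivAt (transportFun L n h φ)
      (φ (transportFlow L n (-h) (transportFlow L n h Y)) •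
          Complex.ofRealCLM.comp (fderiv ℝ (transportWeight L n h) (transportFlow L n h Y)) +
        (transportWeight L n h (transportFlow L n h Y) : ℂ) •
          (fderiv ℝ φ Y).comp (transportDeriv L n (-h) (transportFlow L n h Y)))
      (transportFlow L n h Y) := h1.mul h2
  rw [h3.fderiv]
  simp only [add_apply, FunLike.coe_smul, Pi.smul_apply,
    ContinuousLinearMap.coe_comp, Function.comp_apply, Complex.ofRealCLM_apply, smul_eq_mul]
  rw [transportFlow_neg_transportFlow, fderiv_transportWeight_single, transportDeriv_apply_single,
    jacFactor_inv_transportFlow hk, fderiv_apply_single_add_smul, weightLogDeriv_transportFlow hk]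
  simp only [Complex.real_smul]
  push_cast
  ring

/-! ### The flattened kinetic density -/

/-- THE FLATTENED KINETIC DENSITY of `φ` at flow time `h`:
`∑ᵢ ∑_c |∂_{i,c}φ(Y) + ((cosh h - cos θᵢ sinh h - 1) k_c/|k|²) k·∇ᵢφ(Y) + (sinh h sin θᵢ k_c/2) φ(Y)|²`
— the kinetic density of `φ^h` pulled back along `F_h` and multiplied by the Jacobian
(`kineticDensityReal_transportFun_transportFlow_mul_det`); it involves `φ`, `∇φ` and smooth explicit
functions of `(h, Y)` only. -/
def flatKineticDensity (L : ℝ) (n : Fin 3 → ℤ) (φ : Config N → ℂ) (h : ℝ) (Y : Config N) : ℝ :=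
  ∑ i : Fin N, ∑ c : Fin 3, ‖fderiv ℝ φ Y (Pi.single i (EuclideanSpace.single c 1)) +
    ((cosh h - cos (phase L n Y i) * sinh h - 1) * (2 * π / L * (n c : ℝ)) / ksq L n) •
      kDeriv L n φ Y i +
    (sinh h * sin (phase L n Y i) * (2 * π / L * (n c : ℝ)) / 2) • φ Y‖ ^ 2

/-- At `h = 0` the flattened kinetic density is the kinetic density. [folklore] -/
theorem flatKineticDensity_zero (L : ℝ) (n : Fin 3 → ℤ) (φ : Config N → ℂ) (Y : Config N) :
    flatKineticDensity L n φ 0 Y = kineticDensityReal φ Y := by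
  simp [flatKineticDensity, kineticDensityReal]

/-- **THE KINETIC DENSITY IN FLATTENED VARIABLES**:
`|∇φ^h|²(F_h Y) · det DF_h(Y) = flatKineticDensity L n φ h Y` (`W_h(F_h Y)² det DF_h(Y) = 1`).
[folklore] -/
theorem kineticDensityReal_transportFun_transportFlow_mul_det (hk : ksq L n ≠ 0) {φ : Config N → ℂ}
    (hφ : Differentiable ℝ φ) (h : ℝ) (Y : Config N) :
    kineticDensityReal (transportFun L n h φ) (transportFlow L n h Y) * (transportDeriv L n h Y).det =
      flatKineticDensity L n φ h Y := by
  unfold kineticDensityReal flatKineticDensity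
  simp_rw [fderiv_transportFun_transportFlow_single hk hφ h Y, norm_mul, mul_pow, Complex.norm_real,
    Real.norm_eq_abs, sq_abs, ← Finset.mul_sum]
  rw [transportWeight_transportFlow_sq hk, mul_comm, ← mul_assoc,
    mul_inv_cancel₀ (det_transportDeriv_pos hk h Y).ne', one_mul]

/-- The kinetic density of a lattice-periodic function is lattice periodic. [folklore] -/
theorem kineticDensityReal_add_single {ψ : Config N → ℂ}
    (hψ : ∀ (X : Config N) (i : Fin N) (c : Fin 3),
      ψ (X + Pi.single i (EuclideanSpace.single c L)) = ψ X)
    (X : Config N) (i : Fin N) (c : Fin 3) :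
    kineticDensityReal ψ (X + Pi.single i (EuclideanSpace.single c L)) = kineticDensityReal ψ X := by
  unfold kineticDensityReal
  have h : (fun Y => ψ (Y + Pi.single i (EuclideanSpace.single c L))) = ψ := funext fun Y => hψ Y i c
  rw [← fderiv_comp_add_right, h]

/-- **FLATTENING OF THE KINETIC ENERGY**: for `L > 0`, `|k|² ≠ 0` and a `C¹` lattice-periodic `φ`,
`∫_cell |∇φ^h|² dX = ∫_cell flatKineticDensity L n φ h Y dY` (torus change of variables
`X = F_h(Y)`, `integral_cellN_comp_equivariant`, and the pointwise identity). [folklore] -/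
theorem integral_kineticDensityReal_transportFun (hL : 0 < L) (hk : ksq L n ≠ 0) {φ : Config N → ℂ}
    (hφ : ContDiff ℝ 1 φ)
    (hper : ∀ (X : Config N) (i : Fin N) (c : Fin 3),
      φ (X + Pi.single i (EuclideanSpace.single c L)) = φ X) (h : ℝ) :
    ∫ X in cellN N L, kineticDensityReal (transportFun L n h φ) X =
      ∫ Y in cellN N L, flatKineticDensity L n φ h Y := by
  rw [← integral_cellN_comp_equivariant hL (hasFDerivAt_transportFlow L n h)
    (bijective_transportFlow L n h) (transportFlow_add_single L n h)
    (G := kineticDensityReal (transportFun L n h φ))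
    (kineticDensityReal_add_single (transportFun_add_single L n h hper))]
  refine integral_congr_ae (Filter.Eventually.of_forall fun Y => ?_)
  show |(transportDeriv L n h Y).det| • _ = _
  rw [smul_eq_mul, abs_of_pos (det_transportDeriv_pos hk h Y), mul_comm]
  exact kineticDensityReal_transportFun_transportFlow_mul_det hk (hφ.differentiable one_ne_zero) h Y

/-- The same for the kinetic energy `T_L` (`cellKineticEnergy`). [folklore] -/
theorem cellKineticEnergy_transportFun (hL : 0 < L) (hk : ksq L n ≠ 0) {φ : Config N → ℂ}
    (hφ : ContDiff ℝ 1 φ)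
    (hper : ∀ (X : Config N) (i : Fin N) (c : Fin 3),
      φ (X + Pi.single i (EuclideanSpace.single c L)) = φ X) (h : ℝ) :
    cellKineticEnergy L (transportFun L n h φ) = ∫ Y in cellN N L, flatKineticDensity L n φ h Y :=
  integral_kineticDensityReal_transportFun hL hk hφ hper h

/-! ### The registered sub-goal -/

/-- **Registered sub-goal `stub_kineticFlattening` of S1** (line `force-balance-constitutive`, crux
stmt-AtomisticToContinuum-9481): for `L > 0`, a mode `n ≠ 0`, a `C¹` lattice-periodic `φ` and every
flow time `h`, the kinetic density of the transported wave function `φ^h = (φ ∘ F_{-h}) · W_h` pulled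
back along the flow and weighted by the Jacobian is the flattened kinetic density,
`|∇φ^h|²(F_h Y) det DF_h(Y) = flatKineticDensity L n φ h Y`, and the kinetic energy flattens,
`∫_cell |∇φ^h|² = ∫_cell flatKineticDensity L n φ h`. [folklore] -/
theorem stub_kineticFlattening : ∀ (N : ℕ) (L : ℝ) (n : Fin 3 → ℤ), 0 < L → n ≠ 0 →
    ∀ (φ : (Fin N → EuclideanSpace ℝ (Fin 3)) → ℂ), ContDiff ℝ 1 φ →
    (∀ (X : Fin N → EuclideanSpace ℝ (Fin 3)) (i : Fin N) (c : Fin 3),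
      φ (X + Pi.single i (EuclideanSpace.single c L)) = φ X) →
    ∀ h : ℝ,
    (∀ Y : Fin N → EuclideanSpace ℝ (Fin 3),
      Literature.MathematicalPhysics.QuantumManyBody.BoseGas.kineticDensityReal (transportFun L n h φ)
          (transportFlow L n h Y) * (transportDeriv L n h Y).det =
        flatKineticDensity L n φ h Y) ∧
    ∫ X in Literature.MathematicalPhysics.QuantumManyBody.BoseGas.cellN N L,
        Literature.MathematicalPhysics.QuantumManyBody.BoseGas.kineticDensityReal (transportFun L n h φ) X =
      ∫ Y in Literature.MathematicalPhysics.QuantumManyBody.BoseGas.cellN N L,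
        flatKineticDensity L n φ h Y :=
  fun _ _ _ hL hn _ hφ hper h =>
    ⟨fun Y => kineticDensityReal_transportFun_transportFlow_mul_det (ksq_pos hL.ne' hn).ne'
        (hφ.differentiable one_ne_zero) h Y,
      integral_kineticDensityReal_transportFun hL (ksq_pos hL.ne' hn).ne' hφ hper h⟩

end

end Summit.AtomisticToContinuum.BoseEinsteinCondensation.Cruxes.DensityResponse.ForceBalanceConstitutive
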